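import Summits.ResolutionOfSingularities.KangarooAtlas.MizutaniHSchemeExponent
import HarnessLib

/-!
# Reduction to ONE top invariant form (Mizutani 1973, Lemma 2.6 = Oda 1973 Prop. 3.1, for points): minimal-support forms

Cell `pub-rosobs`, Mizutani enclosure (seat mizutani-encloser-2, gen 9). AI-written; *AI review is weaker than expert
review*; NOT a resolution-of-singularities theorem (summit relevance C).

> **Mizutani 1973, Lemma 2.6 (Oda [3], Prop. 3.1).** "Let `H = H(V, W)` be an H-scheme with `dim H = d`, `e(H) = e` and
> `dim_k V = v`. Then there exists a `k^{p^e}`-basis `{X_i, Y_j}` of `W` and a `k`-basis `{f_j}_{j=1,…,v}` of `V` such that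
> `f_j = Y_j + c_{1j}X_1 + ⋯` and `𝒥_e𝒟_e(f_j) = k·f_j`. Moreover we can choose `f_1` so that `H_1 = H(k·f_1, …)` is an
> H-scheme with `dim H_1 = d` and `e(H_1) = e`."

For a point `𝔭` of `ℙ^n_k` with top invariant forms `V = (L_B)_{e+1}(𝔭) ⊂ k^{n+1}` this file proves the content of the lemma
with MINIMAL-SUPPORT forms in place of an echelon basis (no coordinate change is needed):

* `exists_minSupp_le` — below every nonzero vector of a subspace `V ⊆ k^{n+1}` lies a nonzero vector of `V` of minimal support;
  `mem_span_singleton_of_minSupp` — a vector of `V` supported inside a minimal support is a multiple (the «circuit» property);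
  **`span_minSupp_eq`** — the minimal-support vectors SPAN `V`;
* `apply_eq_zero_of_mem_dSpan_span_singleton` — `𝒟_e(k·f)` is supported inside `supp f`; hence
  **`jCore_dSpan_span_singleton_of_minSupp`** — for `V = (L_B)_e(𝔭)` (which is `𝒥_e𝒟_e`-closed, `jCore_dSpan_invForms`) and `f ∈ V`
  of minimal support, **`𝒥_e𝒟_e(k·f) = k·f`**: each such line is itself the top invariant forms of a point of `ℙ^n_k` of exponent `≤ e`
  (`exists_point_invForms_eq_span_singleton`, via encloser-1 g9's `exists_isPoint_invForms_eq_iff`) — Lemma 2.6's «`𝒥_e𝒟_e(f_j) = k f_j`»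
  for a spanning family;
* **`exists_point_exponent_eq_invForms_eq_span_singleton`** — «moreover we can choose `f_1` …»: if `exponent B(𝔭) = e + 1` EXACTLY,
  some minimal-support `f ∈ (L_B)_{e+1}(𝔭)` spans a line NOT defined over `k^p`, and there is a point `𝔭₁` of `ℙ^n_k` with
  `exponent B(𝔭₁) = e + 1` and `(L_B)_{e+1}(𝔭₁) = k·f ⊆ (L_B)_{e+1}(𝔭)` — ONE top invariant form (`finrank = 1`,
  `hsDim 𝔭₁ = n`; the same ambient `ℙ^n`: Mizutani's `H_1 ×` a vector group; shrinking the ambient space to `ℙ^{dim B}` is not done here).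

## References

* H. Mizutani, *Hironaka's additive group schemes*, Nagoya Math. J. 52 (1973) 85–95, Lemma 2.6 (p. 89), Thm. 1.3. [Mizutani1973HironakaGroupSchemes]
* T. Oda, *Hironaka's additive group scheme, II*, Publ. RIMS 19 (1983), §3 (Thm. 3.1, the versal family). [Oda1983HironakaGroupSchemeII]
-/

noncomputable section

open MvPolynomial Literature.AlgebraicGeometry.Resolution Literature.AlgebraicGeometry.Resolution.HironakaScheme
  Literature.RingTheory.MvPolynomial

namespace Summit.ResolutionOfSingularities.KangarooAtlas.Mizutani

universe u

/-! ## Minimal-support vectors of a subspace of `k^{n+1}` -/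

section MinSupp

variable (k : Type u) [Field k] {n : ℕ}

/-- Killing one coordinate inside the support: `g − (g i₀ / f i₀) • f` vanishes at `i₀` and wherever both vanish. [folklore] -/
theorem sub_smul_apply_eq_zero {f g : Fin (n + 1) → k} {i₀ : Fin (n + 1)} (hf : f i₀ ≠ 0) :
    (g - (g i₀ / f i₀) • f) i₀ = 0 := by
  simp only [Pi.sub_apply, Pi.smul_apply, smul_eq_mul]
  rw [div_mul_cancel₀ _ hf, sub_self]

/-- The support of `g − c • f` lies in `supp f ∪ supp g`. [folklore] -/
theorem sub_smul_apply_eq_zero_of_eq_zero {f g : Fin (n + 1) → k} (c : k) {i : Fin (n + 1)} (hf : f i = 0) (hg : g i = 0) :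
    (g - c • f) i = 0 := by
  simp only [Pi.sub_apply, Pi.smul_apply, smul_eq_mul, hf, hg, mul_zero, sub_zero]

/-- **Below every nonzero vector of `V` lies a MINIMAL-SUPPORT nonzero vector of `V`** (a vector `f ∈ V`, `f ≠ 0`, such that every
nonzero `g ∈ V` supported inside `supp f` has `supp g = supp f`). [folklore] -/
theorem exists_minSupp_le (V : Submodule k (Fin (n + 1) → k)) {w : Fin (n + 1) → k} (hwV : w ∈ V) (hw0 : w ≠ 0) :
    ∃ f ∈ V, f ≠ 0 ∧ (∀ i, w i = 0 → f i = 0) ∧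
      ∀ g ∈ V, g ≠ 0 → (∀ i, f i = 0 → g i = 0) → ∀ i, g i = 0 → f i = 0 := by
  classical
  -- minimise the number of nonzero coordinates among the nonzero vectors of `V` supported inside `supp w`
  have hex : ∃ m, ∃ f ∈ V, f ≠ 0 ∧ (∀ i, w i = 0 → f i = 0) ∧ (Finset.univ.filter fun i => f i ≠ 0).card = m :=
    ⟨_, w, hwV, hw0, fun _ h => h, rfl⟩
  obtain ⟨f, hfV, hf0, hfw, hcard⟩ := Nat.find_spec hex
  refine ⟨f, hfV, hf0, hfw, fun g hgV hg0 hgf i hgi => ?_⟩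
  by_contra hfi
  -- `g` has strictly fewer nonzero coordinates than `f`: contradiction with minimality
  have hlt : (Finset.univ.filter fun j => g j ≠ 0).card < (Finset.univ.filter fun j => f j ≠ 0).card := by
    apply Finset.card_lt_card
    refine ⟨fun j hj => ?_, fun hsub => ?_⟩
    · rw [Finset.mem_filter] at hj ⊢
      exact ⟨hj.1, fun h => hj.2 (hgf j h)⟩
    · have hi : i ∈ Finset.univ.filter fun j => f j ≠ 0 := Finset.mem_filter.mpr ⟨Finset.mem_univ i, hfi⟩
      exact (Finset.mem_filter.mp (hsub hi)).2 hgi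
  have hmin := Nat.find_min hex (hcard ▸ hlt)
  exact hmin ⟨g, hgV, hg0, fun j hj => hgf j (hfw j hj), rfl⟩

/-- **The circuit property**: if `f ∈ V` has minimal support, every `g ∈ V` supported inside `supp f` is a multiple of `f`.
[folklore] -/
theorem mem_span_singleton_of_minSupp (V : Submodule k (Fin (n + 1) → k)) {f : Fin (n + 1) → k} (hfV : f ∈ V)
    (hf0 : f ≠ 0) (hmin : ∀ g ∈ V, g ≠ 0 → (∀ i, f i = 0 → g i = 0) → ∀ i, g i = 0 → f i = 0)
    {g : Fin (n + 1) → k} (hgV : g ∈ V) (hgf : ∀ i, f i = 0 → g i = 0) : g ∈ k ∙ f := by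
  obtain ⟨i₀, hi₀⟩ : ∃ i₀, f i₀ ≠ 0 := by
    by_contra h
    push Not at h
    exact hf0 (funext h)
  set h := g - (g i₀ / f i₀) • f with hh
  have hhV : h ∈ V := V.sub_mem hgV (V.smul_mem _ hfV)
  by_cases hh0 : h = 0
  · rw [Submodule.mem_span_singleton]
    refine ⟨g i₀ / f i₀, ?_⟩
    rw [hh, sub_eq_zero] at hh0
    exact hh0.symm
  · exfalso
    have hsupp : ∀ i, f i = 0 → h i = 0 := fun i hi => sub_smul_apply_eq_zero_of_eq_zero k _ hi (hgf i hi)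
    have := hmin h hhV hh0 hsupp i₀ (sub_smul_apply_eq_zero k hi₀)
    exact hi₀ this

/-- **The minimal-support vectors span `V`** (kill one coordinate of `w` with a minimal-support vector below it and induct on the
number of nonzero coordinates). [folklore] -/
theorem span_minSupp_eq (V : Submodule k (Fin (n + 1) → k)) :
    Submodule.span k {f | f ∈ V ∧ f ≠ 0 ∧ ∀ g ∈ V, g ≠ 0 → (∀ i, f i = 0 → g i = 0) → ∀ i, g i = 0 → f i = 0} = V := by
  classical
  refine le_antisymm (Submodule.span_le.mpr fun f hf => hf.1) ?_
  -- every `w ∈ V` with at most `m` nonzero coordinates lies in the span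
  suffices h : ∀ m, ∀ w ∈ V, (Finset.univ.filter fun i => w i ≠ 0).card ≤ m →
      w ∈ Submodule.span k {f | f ∈ V ∧ f ≠ 0 ∧
        ∀ g ∈ V, g ≠ 0 → (∀ i, f i = 0 → g i = 0) → ∀ i, g i = 0 → f i = 0} from
    fun w hw => h _ w hw le_rfl
  intro m
  induction m with
  | zero =>
    intro w _ hw
    have h0 : w = 0 := by
      funext i
      by_contra hi
      have : i ∈ Finset.univ.filter fun j => w j ≠ 0 := Finset.mem_filter.mpr ⟨Finset.mem_univ i, hi⟩
      rw [Finset.card_eq_zero.mp (Nat.le_zero.mp hw)] at this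
      exact Finset.notMem_empty i this
    rw [h0]
    exact Submodule.zero_mem _
  | succ m ih =>
    intro w hwV hw
    by_cases hw0 : w = 0
    · rw [hw0]; exact Submodule.zero_mem _
    obtain ⟨f, hfV, hf0, hfw, hmin⟩ := exists_minSupp_le k V hwV hw0
    obtain ⟨i₀, hi₀⟩ : ∃ i₀, f i₀ ≠ 0 := by
      by_contra h
      push Not at h
      exact hf0 (funext h)
    have hwi₀ : w i₀ ≠ 0 := fun h => hi₀ (hfw i₀ h)
    -- `w' = w − (w i₀ / f i₀) f` has fewer nonzero coordinates
    set w' := w - (w i₀ / f i₀) • f with hw'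
    have hw'V : w' ∈ V := V.sub_mem hwV (V.smul_mem _ hfV)
    have hlt : (Finset.univ.filter fun j => w' j ≠ 0).card < (Finset.univ.filter fun j => w j ≠ 0).card := by
      apply Finset.card_lt_card
      refine ⟨fun j hj => ?_, fun hsub => ?_⟩
      · rw [Finset.mem_filter] at hj ⊢
        refine ⟨hj.1, fun h => hj.2 (sub_smul_apply_eq_zero_of_eq_zero k _ (hfw j h) h)⟩
      · have hi : i₀ ∈ Finset.univ.filter fun j => w j ≠ 0 := Finset.mem_filter.mpr ⟨Finset.mem_univ _, hwi₀⟩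
        exact (Finset.mem_filter.mp (hsub hi)).2 (sub_smul_apply_eq_zero k hi₀)
    have hmem' := ih w' hw'V (by omega)
    have hf : f ∈ Submodule.span k {f | f ∈ V ∧ f ≠ 0 ∧
        ∀ g ∈ V, g ≠ 0 → (∀ i, f i = 0 → g i = 0) → ∀ i, g i = 0 → f i = 0} :=
      Submodule.subset_span ⟨hfV, hf0, hmin⟩
    have hw_eq : w = w' + (w i₀ / f i₀) • f := by rw [hw', sub_add_cancel]
    rw [hw_eq]
    exact Submodule.add_mem _ hmem' (Submodule.smul_mem _ _ hf)

end MinSupp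

/-! ## Minimal-support invariant forms span `𝒥𝒟`-closed lines -/

section Lines

variable (k : Type u) [Field k] (p : ℕ) [hp : Fact p.Prime] [CharP k p] {n : ℕ} (e : ℕ)

/-- **`𝒟_e(k·f)` is supported inside `supp f`**: a differential operator acts coordinatewise and kills `0`. [cite: Mizutani1973HironakaGroupSchemes, §1 (b) (𝒟_i)] -/
theorem apply_eq_zero_of_mem_dSpan_span_singleton {f w : Fin (n + 1) → k} (hw : w ∈ dSpan k p e (k ∙ f)) {i : Fin (n + 1)}
    (hi : f i = 0) : w i = 0 := by
  unfold dSpan at hw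
  induction hw using Submodule.span_induction with
  | mem x hx =>
    obtain ⟨v, hv, D, -, rfl⟩ := hx
    obtain ⟨c, rfl⟩ := Submodule.mem_span_singleton.mp hv
    show D ((c • f) i) = 0
    rw [Pi.smul_apply, hi, smul_zero, map_zero]
  | zero => rfl
  | add x y _ _ hx hy => rw [Pi.add_apply, hx, hy, add_zero]
  | smul c x _ hx => rw [Pi.smul_apply, hx, smul_zero]

/-- **`𝒥_e𝒟_e(k·f) = k·f` for a minimal-support vector `f` of a `𝒥_e𝒟_e`-closed subspace `V`** (`𝒥𝒟(kf) ⊆ 𝒥𝒟(V) = V`, and `𝒥𝒟(kf) ⊆ 𝒟(kf)`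
is supported inside `supp f`, so the circuit property applies). [cite: Mizutani1973HironakaGroupSchemes, Lemma 2.6 (𝒥_e𝒟_e(f_j) = k f_j)] -/
theorem jCore_dSpan_span_singleton_of_minSupp {V : Submodule k (Fin (n + 1) → k)} (hV : jCore k p e (dSpan k p e V) = V)
    {f : Fin (n + 1) → k} (hfV : f ∈ V) (hf0 : f ≠ 0)
    (hmin : ∀ g ∈ V, g ≠ 0 → (∀ i, f i = 0 → g i = 0) → ∀ i, g i = 0 → f i = 0) :
    jCore k p e (dSpan k p e (k ∙ f)) = k ∙ f := by
  refine le_antisymm ?_ (le_jCore_dSpan k p e _)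
  intro a ha
  have haV : a ∈ V := by
    rw [← hV]
    exact jCore_mono k p e (dSpan_mono k p e ((Submodule.span_singleton_le_iff_mem f V).mpr hfV)) ha
  have haD : a ∈ dSpan k p e (k ∙ f) := jCore_le k p e _ ha
  exact mem_span_singleton_of_minSupp k V hfV hf0 hmin haV
    (fun i hi => apply_eq_zero_of_mem_dSpan_span_singleton k p e haD hi)

variable (𝔭 : Ideal (MvPolynomial (Fin (n + 1)) k))

/-- **Every minimal-support top invariant form spans the top invariant forms of a point** (Lemma 2.6's «`𝒥_e𝒟_e(f_j) = k·f_j`», with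
Thm. 1.3): for `f ∈ (L_B)_e(𝔭)` of minimal support there is a point `𝔭_f` of `ℙ^n_k` with `exponent B(𝔭_f) ≤ e` and
`(L_B)_e(𝔭_f) = k·f`. [cite: Mizutani1973HironakaGroupSchemes, Lemma 2.6 and Thm. 1.3] -/
theorem exists_point_invForms_eq_span_singleton [𝔭.IsPrime] (hP : IsPoint k 𝔭) {f : Fin (n + 1) → k}
    (hfV : f ∈ invForms k p 𝔭 e) (hf0 : f ≠ 0)
    (hmin : ∀ g ∈ invForms k p 𝔭 e, g ≠ 0 → (∀ i, f i = 0 → g i = 0) → ∀ i, g i = 0 → f i = 0) :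
    ∃ 𝔮 : Ideal (MvPolynomial (Fin (n + 1)) k), IsPoint k 𝔮 ∧ ExponentLE k p 𝔮 e ∧ invForms k p 𝔮 e = k ∙ f := by
  refine (exists_isPoint_invForms_eq_iff k p e _).mpr ⟨?_, ?_⟩
  · intro htop
    apply invForms_ne_top k p e 𝔭 hP
    exact eq_top_iff.mpr (htop ▸ (Submodule.span_singleton_le_iff_mem f _).mpr hfV)
  · exact jCore_dSpan_span_singleton_of_minSupp k p e (jCore_dSpan_invForms k p 𝔭 e) hfV hf0 hmin

/-- **The top invariant forms of every point are SPANNED by closed lines, each the top forms of a point** — Lemma 2.6's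
basis `{f_j}` with `𝒥_e𝒟_e(f_j) = k·f_j`, for points, with minimal-support forms. [cite: Mizutani1973HironakaGroupSchemes, Lemma 2.6] -/
theorem invForms_eq_span_realised_lines [𝔭.IsPrime] (hP : IsPoint k 𝔭) :
    invForms k p 𝔭 e = Submodule.span k {f | f ∈ invForms k p 𝔭 e ∧ f ≠ 0 ∧
      ∃ 𝔮 : Ideal (MvPolynomial (Fin (n + 1)) k), IsPoint k 𝔮 ∧ ExponentLE k p 𝔮 e ∧ invForms k p 𝔮 e = k ∙ f} := by
  refine le_antisymm ?_ (Submodule.span_le.mpr fun f hf => hf.1)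
  conv_lhs => rw [← span_minSupp_eq k (invForms k p 𝔭 e)]
  refine Submodule.span_mono fun f hf => ⟨hf.1, hf.2.1, ?_⟩
  exact exists_point_invForms_eq_span_singleton k p e 𝔭 hP hf.1 hf.2.1 hf.2.2

/-- **LEMMA 2.6, «MOREOVER», FOR POINTS: ONE TOP FORM WITH THE SAME EXPONENT.**  If `exponent B(𝔭) = e + 1` exactly, then some
minimal-support `f ∈ (L_B)_{e+1}(𝔭)` spans a line not defined over `k^p`, and there is a point `𝔭₁` of `ℙ^n_k` with
`exponent B(𝔭₁) = e + 1` and `(L_B)_{e+1}(𝔭₁) = k·f ⊆ (L_B)_{e+1}(𝔭)` — a Hironaka scheme with ONE top invariant form dominated by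
`𝔭`'s (in the same `ℙ^n`; `dim B(𝔭₁) = n`). [cite: Mizutani1973HironakaGroupSchemes, Lemma 2.6 ("Moreover we can choose f_1 so that … e(H_1) = e")] -/
theorem exists_point_exponent_eq_invForms_eq_span_singleton [𝔭.IsPrime] (hP : IsPoint k 𝔭) (he : exponent k p 𝔭 = e + 1) :
    ∃ f ∈ invForms k p 𝔭 (e + 1), f ≠ 0 ∧
      ∃ 𝔭₁ : Ideal (MvPolynomial (Fin (n + 1)) k), IsPoint k 𝔭₁ ∧ exponent k p 𝔭₁ = e + 1 ∧
        invForms k p 𝔭₁ (e + 1) = k ∙ f := by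
  classical
  set V := invForms k p 𝔭 (e + 1) with hVdef
  obtain ⟨hne, hcl, hiii⟩ := (exists_isPoint_exponent_eq_succ_iff k p e V).mp ⟨𝔭, hP, he, rfl⟩
  -- some minimal-support `f` spans a line not defined over `k^p`
  have hex : ∃ f, f ∈ V ∧ f ≠ 0 ∧ (∀ g ∈ V, g ≠ 0 → (∀ i, f i = 0 → g i = 0) → ∀ i, g i = 0 → f i = 0) ∧
      (k ∙ f) ≠ Submodule.span k (((k ∙ f : Submodule k (Fin (n + 1) → k)) : Set (Fin (n + 1) → k)) ∩
        Set.range (frobVec k p 1)) := by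
    by_contra hall
    push Not at hall
    apply hiii
    refine le_antisymm ?_ (Submodule.span_le.mpr fun g hg => hg.1)
    conv_lhs => rw [← span_minSupp_eq k V]
    rw [Submodule.span_le]
    rintro f ⟨hfV, hf0, hmin⟩
    have hline := hall f hfV hf0 hmin
    have hf : f ∈ (k ∙ f : Submodule k (Fin (n + 1) → k)) := Submodule.mem_span_singleton_self f
    rw [hline] at hf
    refine Submodule.span_mono ?_ hf
    exact Set.inter_subset_inter_left _ fun g hg =>
      (Submodule.span_singleton_le_iff_mem f V).mpr hfV hg
  obtain ⟨f, hfV, hf0, hmin, hfp⟩ := hex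
  have hne₁ : (k ∙ f : Submodule k (Fin (n + 1) → k)) ≠ ⊤ := fun htop =>
    hne (eq_top_iff.mpr (htop ▸ (Submodule.span_singleton_le_iff_mem f V).mpr hfV))
  obtain ⟨𝔭₁, hP₁, he₁, hinv₁⟩ := (exists_isPoint_exponent_eq_succ_iff k p e (k ∙ f)).mpr
    ⟨hne₁, jCore_dSpan_span_singleton_of_minSupp k p (e + 1) hcl hfV hf0 hmin, hfp⟩
  exact ⟨f, hfV, hf0, 𝔭₁, hP₁, he₁, hinv₁⟩

/-- Its numerical shadow: `finrank (L_B)_{e+1}(𝔭₁) = 1` and `hsDim 𝔭₁ = n`. [cite: Mizutani1973HironakaGroupSchemes, Lemma 2.6] -/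
theorem exists_point_exponent_eq_finrank_invForms_eq_one [𝔭.IsPrime] (hP : IsPoint k 𝔭) (he : exponent k p 𝔭 = e + 1) :
    ∃ 𝔭₁ : Ideal (MvPolynomial (Fin (n + 1)) k), IsPoint k 𝔭₁ ∧ exponent k p 𝔭₁ = e + 1 ∧
      invForms k p 𝔭₁ (e + 1) ≤ invForms k p 𝔭 (e + 1) ∧ Module.finrank k (invForms k p 𝔭₁ (e + 1)) = 1 ∧
      hsDim k p 𝔭₁ = n := by
  obtain ⟨f, hfV, hf0, 𝔭₁, hP₁, he₁, hinv₁⟩ := exists_point_exponent_eq_invForms_eq_span_singleton k p e 𝔭 hP he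
  haveI := hP₁.1
  have hfin : Module.finrank k (invForms k p 𝔭₁ (e + 1)) = 1 := by
    rw [hinv₁]; exact finrank_span_singleton hf0
  refine ⟨𝔭₁, hP₁, he₁, hinv₁ ▸ (Submodule.span_singleton_le_iff_mem f _).mpr hfV, hfin, ?_⟩
  have hE₁ : ExponentLE k p 𝔭₁ (e + 1) := (exponent_le_iff k p 𝔭₁).mp he₁.le
  rw [← hsDimAt_eq_hsDim k p 𝔭₁ hE₁]
  unfold hsDimAt
  rw [hfin]
  omega

end Lines

end Summit.ResolutionOfSingularities.KangarooAtlas.Mizutani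

end
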